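import Summits.QuantumFields.YangMills.Theorems.IR.Negative.TypOnsetFloorPoly.GibbsCore

/-!
# Crux `IR` (stmt-QuantumFields-19354) — the POLYNOMIAL ROW FLOOR `b⋆_T(β) ≥ c·(β / log β)^{1/7}` for EVERY compact gauge group,
# part 2/10: §3 the polynomial regime and the three Props, §4 the reduction, §3b non-vacuity hygiene, §4b quantitative non-abelian Stokes (sections `Poly`, `Hygiene`, `QuantStokes`)

Re-homed VERBATIM (statements, proofs, names; namespace `…Cruxes.IR.CruxIdea2g7` ↦ `…Cruxes.IR.RowFloorPoly`) from the crux
workfile `Cruxes/IR/CruxIdea2RowFloorPoly.lean` rev 14 (sha16 742d7312ea0b5c70; author `ym-cruxidea-19354-2` GEN 7; kernel certificate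
`Cruxes/IR/CruxIdea2RowFloorPolyCert.lean` rev 1, sha16 59d3cfe64fab9c7c, gate-elaborated stub-free) per owner R114 (2) (landing seat:
the `ym-19354-disprove-1` lineage, g9), split by its sections into ten ≤ 400-line modules chained by import; the module docstring of
record (history, theorem map, honest framing) is in the headline module `Theorems/IR/Negative/TypOnsetFloorPoly.lean` (part 10/10).
Negative knowledge for stmt-QuantumFields-19354 (`--supports`; closes no stub); not mixing, not a mass gap, nothing about Clay.
-/

set_option autoImplicit false

noncomputable section

open MeasureTheory Filter Topology
open Literature.MathematicalPhysics.QuantumLattice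
open Literature.Probability.LatticeModels
open Summit.QuantumFields.YangMills.Cruxes.IR.Tempered (cellEdges windowCells regionEdges)
open Summit.QuantumFields.YangMills.Cruxes.IR.ShellTempered (windowCellsPlus)
open Summit.QuantumFields.YangMills.Cruxes.IR.OnsetFormats (TypShellCond shellCount)
open Summit.QuantumFields.YangMills.Cruxes.IR.FixedMesh
open Summit.QuantumFields.YangMills.Cruxes.IR.FixedMeshAllG

namespace Summit.QuantumFields.YangMills.Cruxes.IR.RowFloorPoly

/-! ## §3 The polynomial regime and the three Props -/

section Poly

open Literature.MathematicalPhysics.QuantumFieldTheory (wilsonMeasure GaugeConfig isProbabilityMeasure_wilsonMeasure)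

variable {G : Type} [Group G] [TopologicalSpace G] [IsTopologicalGroup G] [CompactSpace G]
  [SecondCountableTopology G] [MeasurableSpace G] [BorelSpace G]
  {N : ℕ} (ρ : G →* Matrix (Fin N) (Fin N) ℂ)

/-- The CLIPPED shaping of the charged test (GEN 6 rev 2, `frame_core_comb_clipped`): affine with `ψ 1 = 1`,
`ψ r = −1`, clipped to `[−1, 1]`. -/
def clip (r t : ℝ) : ℝ := max (-1) (min 1 (2 * (t - r) / (1 - r) - 1))

omit [TopologicalSpace G] [IsTopologicalGroup G] [CompactSpace G] [SecondCountableTopology G] [MeasurableSpace G]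
  [BorelSpace G] in
/-- Helper lemma `continuous_clip` of the row-floor chain (re-homed verbatim from the crux workfile; see the module docstring). -/
theorem continuous_clip (r : ℝ) : Continuous (clip r) := by
  unfold clip
  exact continuous_const.max (continuous_const.min
    (((continuous_const.mul (continuous_id.sub continuous_const)).div_const _).sub continuous_const))

/-- Helper lemma `abs_clip_le` of the row-floor chain (re-homed verbatim from the crux workfile; see the module docstring). -/
theorem abs_clip_le (r t : ℝ) : |clip r t| ≤ 1 :=
  abs_le.2 ⟨le_max_left _ _, max_le (by norm_num) (min_le_left _ _)⟩

/-- Helper lemma `one_sub_clip_le` of the row-floor chain (re-homed verbatim from the crux workfile; see the module docstring). -/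
theorem one_sub_clip_le {r : ℝ} (hr : r < 1) (t : ℝ) (ht : t ≤ 1) :
    1 - clip r t ≤ 2 / (1 - r) * (1 - t) := by
  have h1r : 0 < 1 - r := by linarith
  unfold clip
  have hφ : 1 - (2 * (t - r) / (1 - r) - 1) = 2 / (1 - r) * (1 - t) := by
    field_simp
    ring
  have hmin : min 1 (2 * (t - r) / (1 - r) - 1) ≤ max (-1) (min 1 (2 * (t - r) / (1 - r) - 1)) :=
    le_max_right _ _
  rcases le_total 1 (2 * (t - r) / (1 - r) - 1) with h | h
  · rw [min_eq_left h] at hmin ⊢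
    have : 0 ≤ 2 / (1 - r) * (1 - t) := mul_nonneg (div_nonneg (by norm_num) h1r.le) (by linarith)
    linarith
  · rw [min_eq_right h] at hmin ⊢
    linarith

/-- Helper lemma `clip_self` of the row-floor chain (re-homed verbatim from the crux workfile; see the module docstring). -/
theorem clip_self (r : ℝ) : clip r r = -1 := by
  unfold clip
  rw [sub_self, mul_zero, zero_div, zero_sub, min_eq_right (by norm_num), max_self]

/-- **The polynomial regime** of exponent `θ`, constant `c`, threshold `β₀`: all `(β, b)` with `β ≥ β₀` and
`1 ≤ b ≤ c · (β / log β)^θ`. -/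
def polyRegime (θ c β₀ : ℝ) (P : ℝ → ℕ → Prop) : Prop :=
  ∀ β : ℝ, β₀ ≤ β → ∀ b : ℕ, 1 ≤ b → (b : ℝ) ≤ c * (β / Real.log β) ^ θ → P β b

omit [TopologicalSpace G] [IsTopologicalGroup G] [CompactSpace G] [SecondCountableTopology G] [MeasurableSpace G]
  [BorelSpace G] in
/-- Helper lemma `polyRegime_mono_threshold` of the row-floor chain (re-homed verbatim from the crux workfile; see the module docstring). -/
theorem polyRegime_mono_threshold {θ c β₀ β₀' : ℝ} (hβ : β₀ ≤ β₀') {P : ℝ → ℕ → Prop}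
    (h : polyRegime θ c β₀ P) : polyRegime θ c β₀' P :=
  fun β hβ' b hb hbc => h β (hβ.trans hβ') b hb hbc

omit [TopologicalSpace G] [IsTopologicalGroup G] [CompactSpace G] [SecondCountableTopology G] [MeasurableSpace G]
  [BorelSpace G] in
/-- A smaller exponent is a smaller regime (for `β ≥ 3`, where `β / log β ≥ 1`). -/
theorem polyRegime_mono_exponent {θ θ' c β₀ : ℝ} (hθ : θ' ≤ θ) (hc : 0 ≤ c) (hβ₀ : 3 ≤ β₀)
    {P : ℝ → ℕ → Prop} (h : polyRegime θ c β₀ P) : polyRegime θ' c β₀ P := by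
  intro β hβ b hb hbc
  refine h β hβ b hb (hbc.trans (mul_le_mul_of_nonneg_left ?_ hc))
  have hβ3 : (3 : ℝ) ≤ β := hβ₀.trans hβ
  have hβ0 : (0 : ℝ) < β := by linarith
  have hlogpos : 0 < Real.log β := Real.log_pos (by linarith)
  have h1 : 1 ≤ β / Real.log β := by
    rw [le_div_iff₀ hlogpos, one_mul]
    have := Real.log_le_sub_one_of_pos hβ0
    linarith
  exact Real.rpow_le_rpow_of_exponent_le h1 hθ

/-- **INPUT Freeze_poly — annealed rectangle-loop freezing along the regime.**  For every `η > 0` there are `c > 0`,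
`β₀` with `E_{L_b,β}[W_{b × (2n+1)b} ∘ lift] ≥ 1 − η` for all `(β, b)` in `polyRegime θ c β₀` (torus side
`L_b = 2((2n+2)b+1)+1`).  GEN 6 used the `∃ β₀(b)` form (`FixedMesh.torusLoopFreezing`). -/
def LoopFreezingPoly (n : ℕ) (θ : ℝ) : Prop :=
  ∀ η : ℝ, 0 < η → ∃ c : ℝ, 0 < c ∧ ∃ β₀ : ℝ, polyRegime θ c β₀ fun β b =>
    1 - η ≤ ∫ V, loopObs ρ b ((2 * n + 1) * b) (torusLift (2 * ((2 * n + 2) * b + 1) + 1) V)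
      ∂(wilsonMeasure (d := 4) (L := 2 * ((2 * n + 2) * b + 1) + 1) ρ β)

/-- **INPUT F_poly — the comb-twisted mean of the CLIPPED charged test along the regime.**  For every `η > 0` there are
`c > 0`, `β₀` with `μ_{L_b,β}{V | −1 + η < twistedMeanObs ρ β b n (comb_b k₀) (clip r) V} ≤ η`, `r = Re χ_ρ(k₀)/N`, for all
`(β, b)` in `polyRegime θ c β₀`.  GEN 6 used the `∃ β₀(b)` form (`FixedMeshAllG.frameValueBoundObs_comb`, value
`clip r r = −1`). -/
def FrameValuePoly (n : ℕ) (k₀ : G) (θ : ℝ) : Prop :=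
  ∀ η : ℝ, 0 < η → ∃ c : ℝ, 0 < c ∧ ∃ β₀ : ℝ, polyRegime θ c β₀ fun β b =>
    (wilsonMeasure (d := 4) (L := 2 * ((2 * n + 2) * b + 1) + 1) ρ β)
        {V | -1 + η < twistedMeanObs ρ β b n (comb b ((2 * n + 2) * b + 1) k₀)
          (clip ((ρ k₀).trace.re / N)) V} ≤ ENNReal.ofReal η

set_option linter.dupNamespace false in
/-- **THE TARGET — a polynomial ROW FLOOR of exponent `θ`.**  `∃ c > 0, ∃ β₀, ∀ β ≥ β₀, ∀ b, 1 ≤ b ≤ c (β/log β)^θ →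
¬ TypShellCond ρ β b n ε δ`: clause (i) of the registered format T fails at EVERY mesh below the polynomial floor,
i.e. `b⋆_T(β) > c (β / log β)^θ` eventually (`typFloor_of_rowFloorPoly`). -/
def RowFloorPoly (n : ℕ) (ε δ θ : ℝ) : Prop :=
  ∃ c : ℝ, 0 < c ∧ ∃ β₀ : ℝ, polyRegime θ c β₀ fun β b => ¬ TypShellCond ρ β b n ε δ

omit [SecondCountableTopology G] in
/-- Helper lemma `loopFreezingPoly_mono` of the row-floor chain (re-homed verbatim from the crux workfile; see the module docstring). -/
theorem loopFreezingPoly_mono {n : ℕ} {θ θ' : ℝ} (hθ : θ' ≤ θ) (h : LoopFreezingPoly ρ n θ) :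
    LoopFreezingPoly ρ n θ' := by
  intro η hη
  obtain ⟨c, hc, β₀, h⟩ := h η hη
  exact ⟨c, hc, max β₀ 3, polyRegime_mono_exponent hθ hc.le (le_max_right _ _)
    (polyRegime_mono_threshold (le_max_left _ _) h)⟩

omit [SecondCountableTopology G] in
/-- Helper lemma `frameValuePoly_mono` of the row-floor chain (re-homed verbatim from the crux workfile; see the module docstring). -/
theorem frameValuePoly_mono {n : ℕ} {k₀ : G} {θ θ' : ℝ} (hθ : θ' ≤ θ) (h : FrameValuePoly ρ n k₀ θ) :
    FrameValuePoly ρ n k₀ θ' := by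
  intro η hη
  obtain ⟨c, hc, β₀, h⟩ := h η hη
  exact ⟨c, hc, max β₀ 3, polyRegime_mono_exponent hθ hc.le (le_max_right _ _)
    (polyRegime_mono_threshold (le_max_left _ _) h)⟩

omit [SecondCountableTopology G] in
/-- Helper lemma `rowFloorPoly_mono` of the row-floor chain (re-homed verbatim from the crux workfile; see the module docstring). -/
theorem rowFloorPoly_mono {n : ℕ} {ε δ θ θ' : ℝ} (hθ : θ' ≤ θ) (h : RowFloorPoly ρ n ε δ θ) :
    RowFloorPoly ρ n ε δ θ' := by
  obtain ⟨c, hc, β₀, h⟩ := h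
  exact ⟨c, hc, max β₀ 3, polyRegime_mono_exponent hθ hc.le (le_max_right _ _)
    (polyRegime_mono_threshold (le_max_left _ _) h)⟩

/-! ## §4 The reduction (PROVED): Freeze_poly ∧ F_poly ⇒ the polynomial row floor; format consequences -/

/-- **REDUCTION (PROVED).**  For every compact `G`, continuous faithful unitary `ρ`, `N ≥ 1`, `k₀ ≠ 1`, window `n`,
budgets `ε < 1`, `0 ≤ δ`, `4·#windowCellsPlus(n)·δ < 1`, and every exponent `θ`:
`LoopFreezingPoly ρ n θ → FrameValuePoly ρ n k₀ θ → RowFloorPoly ρ n ε δ θ`.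
Proof: `frame_core_at` with the comb twist (INPUT T = the landed `topTwistTransfer_comb`, uniform in `b` as it stands),
the clipped test (`A = 2/(1−r)`, `v = −1`), budget `s = min ((2 − 2ε)/4) (1/8)`, constants `c = min c₁ c₂`,
`β₀ = max β₁ β₂ ⊔ 1`. -/
theorem rowFloorPoly_of_inputs (hρ : Continuous ρ) (hρi : Function.Injective ρ)
    (hρu : ∀ g, ρ g ∈ Matrix.unitaryGroup (Fin N) ℂ) (hN : 1 ≤ N) {k₀ : G} (hk₀ : k₀ ≠ 1)
    (n : ℕ) {ε δ : ℝ} (hε : ε < 1) (hδ0 : 0 ≤ δ) (hδ : 4 * ((windowCellsPlus n).card : ℝ) * δ < 1)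
    {θ : ℝ} (hFr : LoopFreezingPoly ρ n θ) (hF : FrameValuePoly ρ n k₀ θ) :
    RowFloorPoly ρ n ε δ θ := by
  obtain ⟨r, hrdef⟩ : ∃ r : ℝ, (ρ k₀).trace.re / N = r := ⟨_, rfl⟩
  have hr : r < 1 := hrdef ▸ re_trace_div_lt_one ρ hρi hρu hN hk₀
  have h1r : 0 < 1 - r := by linarith
  -- budgets (value `v = -1`, domination constant `A = 2/(1-r)`)
  set s : ℝ := min ((1 - (-1) - 2 * ε) / 4) (1 / 8) with hs
  have hs0 : 0 < s := lt_min (by linarith) (by norm_num)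
  have hs8 : s ≤ 1 / 8 := min_le_right _ _
  have hs4 : s ≤ (1 - (-1) - 2 * ε) / 4 := min_le_left _ _
  have hA0 : 0 ≤ 2 / (1 - r) := div_nonneg (by norm_num) h1r.le
  have hA1 : 0 < 2 / (1 - r) + 1 := by linarith
  have hss : 0 < s * s / (2 / (1 - r) + 1) := div_pos (mul_pos hs0 hs0) hA1
  obtain ⟨c₁, hc₁, β₁, h₁⟩ := hFr (s * s / (2 / (1 - r) + 1)) hss
  obtain ⟨c₂, hc₂, β₂, h₂⟩ := hF s hs0
  refine ⟨min c₁ c₂, lt_min hc₁ hc₂, max (max β₁ β₂) 1, ?_⟩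
  intro β hβ b hb hbc
  have hβ1 : β₁ ≤ β := ((le_max_left _ _).trans (le_max_left _ _)).trans hβ
  have hβ2 : β₂ ≤ β := ((le_max_right _ _).trans (le_max_left _ _)).trans hβ
  have hβone : (1 : ℝ) ≤ β := (le_max_right _ _).trans hβ
  have hx : 0 ≤ (β / Real.log β) ^ θ :=
    Real.rpow_nonneg (div_nonneg (by linarith) (Real.log_nonneg hβone)) θ
  have hb1 : (b : ℝ) ≤ c₁ * (β / Real.log β) ^ θ :=
    hbc.trans (mul_le_mul_of_nonneg_right (min_le_left _ _) hx)
  have hb2 : (b : ℝ) ≤ c₂ * (β / Real.log β) ^ θ :=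
    hbc.trans (mul_le_mul_of_nonneg_right (min_le_right _ _) hx)
  have hfreeze0 := h₁ β hβ1 b hb hb1
  have hFat := h₂ β hβ2 b hb hb2
  simp only [hrdef] at hFat
  intro hTyp
  obtain ⟨Typ, hmeas, hdep, hI, hanch⟩ := clauseI_of_typShellCond hTyp
  exact frame_core_at ρ hρ hρu hb n (comb b ((2 * n + 2) * b + 1) k₀) (continuous_clip r)
    (fun t _ => abs_clip_le r t) hA0 (one_sub_clip_le hr) (topTwistTransfer_comb ρ hb n k₀) hs0 hs8 hs4
    hfreeze0 hFat hδ0 hδ Typ hmeas hdep (rowClauseI_of_clauseI hI) fun c' hc' =>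
    hanch ((2 * n + 2) * b + 1) (by nlinarith) c' (stdFrame_windowCellsPlus_bounds hc')

omit [SecondCountableTopology G] in
/-- **Format T consequence (PROVED):** every mesh of the registered format T exceeds the floor beyond `β₀`. -/
theorem typFloor_of_rowFloorPoly {n : ℕ} {ε δ θ : ℝ} (h : RowFloorPoly ρ n ε δ θ) :
    ∃ c : ℝ, 0 < c ∧ ∃ β₀ : ℝ, ∀ β : ℝ, β₀ ≤ β → ∀ b : ℕ, 1 ≤ b → TypShellCond ρ β b n ε δ →
      c * (β / Real.log β) ^ θ < b := by
  obtain ⟨c, hc, β₀, h⟩ := h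
  exact ⟨c, hc, β₀, fun β hβ b hb hT => lt_of_not_ge fun hle => h β hβ b hb hle hT⟩

omit [SecondCountableTopology G] in
/-- **Format Uc consequence (PROVED):** every mesh of the slot's format Uc (`AfPincerUc.TypShellCondUKPc`, which implies
the registered T by `AfPincerUc.typShellCond_of_UKPc`) exceeds the floor beyond `β₀`; in particular every witness
mesh `b(β)` that a proof of `stub_onsetUcSC` produces for `(n, ε, δ)` lies above `c (β / log β)^θ`. -/
theorem ukpcFloor_of_rowFloorPoly {n : ℕ} {ε δ θ : ℝ} (h : RowFloorPoly ρ n ε δ θ) :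
    ∃ c : ℝ, 0 < c ∧ ∃ β₀ : ℝ, ∀ β : ℝ, β₀ ≤ β → ∀ b : ℕ, 1 ≤ b →
      AfPincerUc.TypShellCondUKPc ρ β b n ε δ → c * (β / Real.log β) ^ θ < b := by
  obtain ⟨c, hc, β₀, h⟩ := typFloor_of_rowFloorPoly ρ h
  exact ⟨c, hc, β₀, fun β hβ b hb hU => h β hβ b hb (AfPincerUc.typShellCond_of_UKPc hU)⟩

omit [SecondCountableTopology G] in
/-- **Onset form (PROVED):** whenever the slot's format Uc holds at some mesh, its onset `mixOnsetUc` exceeds the floor. -/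
theorem mixOnsetUc_floor_of_rowFloorPoly {n : ℕ} {ε δ θ : ℝ} (h : RowFloorPoly ρ n ε δ θ) :
    ∃ c : ℝ, 0 < c ∧ ∃ β₀ : ℝ, ∀ β : ℝ, β₀ ≤ β →
      (AfPincerUc.fmtSet (fun β' b => AfPincerUc.TypShellCondUKPc ρ β' b n ε δ) β).Nonempty →
        c * (β / Real.log β) ^ θ < AfPincerUc.mixOnsetUc ρ β n ε δ := by
  obtain ⟨c, hc, β₀, h⟩ := ukpcFloor_of_rowFloorPoly ρ h
  refine ⟨c, hc, β₀, fun β hβ hne => ?_⟩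
  have hmem := Nat.sInf_mem hne
  exact h β hβ _ hmem.1 hmem.2

end Poly

/-! ## §3b (PROVED) Hygiene: for `θ > 0` the floor is NOT vacuous — it contains every fixed mesh eventually (ctriage-2 O-FTR-4) -/

section Hygiene

/-- `β / log β → ∞`. -/
theorem tendsto_div_log_atTop' : Tendsto (fun β : ℝ => β / Real.log β) atTop atTop := by
  have h0 : Tendsto (fun β : ℝ => Real.log β / β) atTop (𝓝 0) := by
    have := Real.tendsto_pow_log_div_mul_add_atTop 1 0 1 one_ne_zero
    simpa using this
  have hpos : ∀ᶠ β : ℝ in atTop, 0 < Real.log β / β := by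
    filter_upwards [eventually_gt_atTop 1] with β hβ
    exact div_pos (Real.log_pos hβ) (by linarith)
  have h1 : Tendsto (fun β : ℝ => Real.log β / β) atTop (𝓝[>] 0) :=
    tendsto_nhdsWithin_iff.2 ⟨h0, hpos.mono fun β hβ => hβ⟩
  have h2 := tendsto_inv_nhdsGT_zero.comp h1
  refine h2.congr' ?_
  filter_upwards with β
  simp [inv_div]

/-- For `θ > 0`, `c > 0` the polynomial regime eventually contains ANY fixed bound `B`: `B ≤ c (β / log β)^θ` for `β ≥ β₂`.
(For `θ ≤ 0` the three Props of §3 are trivially inhabited — `c := 1/2`, `β₀ := 3` empties the regime — which is why every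
statement of this file is at `θ = 1/4` or `θ = 1/7`.) -/
theorem polyRegime_eventually_ge {θ c : ℝ} (hθ : 0 < θ) (hc : 0 < c) (B : ℝ) :
    ∃ β₂ : ℝ, ∀ β : ℝ, β₂ ≤ β → B ≤ c * (β / Real.log β) ^ θ := by
  have h := ((tendsto_rpow_atTop hθ).comp tendsto_div_log_atTop').const_mul_atTop hc
  obtain ⟨β₂, hβ₂⟩ := Filter.eventually_atTop.1 (h.eventually_ge_atTop B)
  exact ⟨β₂, fun β hβ => by simpa using hβ₂ β hβ⟩

variable {G : Type} [Group G] [TopologicalSpace G] [IsTopologicalGroup G] [CompactSpace G]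
  [MeasurableSpace G] [BorelSpace G] {N : ℕ} (ρ : G →* Matrix (Fin N) (Fin N) ℂ)

/-- **Non-vacuity (PROVED): a polynomial row floor of exponent `θ > 0` implies the FIXED-MESH negative at every mesh**
(the shape of GEN 6's landed `FixedMeshAllG.not_typShellCond_fixedMesh_allG`): `RowFloorPoly ρ n ε δ θ → ∀ b ≥ 1, ∃ β₂,
∀ β ≥ β₂, ¬ TypShellCond ρ β b n ε δ`.  So `RowFloorPoly ρ n ε δ (1/7)` is strictly contentful. -/
theorem fixedMesh_of_rowFloorPoly {n : ℕ} {ε δ θ : ℝ} (hθ : 0 < θ) (h : RowFloorPoly ρ n ε δ θ) (b : ℕ)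
    (hb : 1 ≤ b) : ∃ β₂ : ℝ, ∀ β : ℝ, β₂ ≤ β → ¬ TypShellCond ρ β b n ε δ := by
  obtain ⟨c, hc, β₀, hreg⟩ := h
  obtain ⟨β₂, hβ₂⟩ := polyRegime_eventually_ge hθ hc (b : ℝ)
  exact ⟨max β₀ β₂, fun β hβ =>
    hreg β ((le_max_left _ _).trans hβ) b hb (hβ₂ β ((le_max_right _ _).trans hβ))⟩

end Hygiene

/-! ## §4b QUANTITATIVE (deterministic) non-abelian Stokes and the annealed loop-freezing RATE (PROVED)

The two inductions of `FixedMesh.strip_eq_one` ∕ `rect_eq_one` (there: flat plaquettes ⇒ loop `= 1`) redone with the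
Frobenius defect `d(X) = ‖ρ(X) − 1‖_F` (`d(XY) ≤ d(X) + d(Y)`, conjugation invariant, `d² = 2(N − Re tr ρ)`), giving for
EVERY configuration `1 − W_{b,m}(U) ≤ ((b+1)m/N) · Σ_{s<m} Σ_{t≤b} (N − Re tr ρ(U_{(t,s)}))` over the planar spanning
surface of the `(b+1) × m` rectangle (`one_sub_loopObs_le`); integrated on the odd torus against the tree's volume-uniform
plaquette moment bound `AfOnset.exists_plaquetteCost_moments_le` (`⟨φ_q⟩ ≤ K(1 + log β)/β`, S2 seat's helper from the
chessboard estimate) this is `one_sub_integral_loopObs_le`, and §5's `loopFreezingPoly_quarter` follows by arithmetic. -/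

section QuantStokes

variable {G : Type} [Group G] {N : ℕ} (ρ : G →* Matrix (Fin N) (Fin N) ℂ)

/-- The `(0,1)`-plaquette holonomy based at `site2 t s`. -/
def plaq (U : LGConfig 4 G) (t s : ℤ) : G := plaquetteHolonomyZd U (site2 t s) 0 1

/-- Boundary holonomy of the one-plaquette-high strip `[0,A] × [M,M+1]`. -/
def stripHol (U : LGConfig 4 G) (M A : ℕ) : G :=
  upT U M A * U (site2 (A : ℤ) M, 1) * (upT U ((M : ℤ) + 1) A)⁻¹ * (U (site2 0 (M : ℤ), 1))⁻¹

/-- Boundary holonomy of the rectangle `[0,A] × [0,M]` based at the origin. -/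
def rectHol (U : LGConfig 4 G) (A M : ℕ) : G :=
  upT U 0 A * rightT U (A : ℤ) M * (upT U (M : ℤ) A)⁻¹ * (rightT U 0 M)⁻¹

/-- The link above a plaquette in terms of the other three links and the plaquette holonomy. -/
theorem link_eq_of_plaq (U : LGConfig 4 G) (t s : ℤ) :
    U (site2 (t + 1) s, 1) = (U (site2 t s, 0))⁻¹ * plaq U t s * U (site2 t s, 1) * U (site2 t (s + 1), 0) := by
  rw [plaq, plaquetteHolonomyZd, site2_add_single_zero, site2_add_single_one]
  group

/-- Helper lemma `stripHol_zero` of the row-floor chain (re-homed verbatim from the crux workfile; see the module docstring). -/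
@[simp] theorem stripHol_zero (U : LGConfig 4 G) (M : ℕ) : stripHol U M 0 = 1 := by
  simp [stripHol]

/-- **Strip recursion**: adding one plaquette multiplies the strip holonomy by a conjugate of that plaquette. -/
theorem stripHol_succ (U : LGConfig 4 G) (M A : ℕ) :
    stripHol U M (A + 1) = (upT U M A * plaq U A M * (upT U M A)⁻¹) * stripHol U M A := by
  simp only [stripHol]
  rw [upT_succ, upT_succ]
  push_cast
  rw [link_eq_of_plaq U (A : ℤ) (M : ℤ)]
  group

/-- Helper lemma `rectHol_zero` of the row-floor chain (re-homed verbatim from the crux workfile; see the module docstring). -/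
@[simp] theorem rectHol_zero (U : LGConfig 4 G) (A : ℕ) : rectHol U A 0 = 1 := by
  simp [rectHol]

/-- **Rectangle recursion**: adding one strip multiplies the rectangle holonomy by a conjugate of the strip holonomy. -/
theorem rectHol_succ (U : LGConfig 4 G) (A M : ℕ) :
    rectHol U A (M + 1) = rectHol U A M * (rightT U 0 M * stripHol U M A * (rightT U 0 M)⁻¹) := by
  simp only [rectHol, stripHol]
  rw [rightT_succ, rightT_succ]
  push_cast
  group

/-- The rectangle loop `col · staple` is a conjugate of `rectHol U (b+1) m`. -/
theorem col_mul_staple_eq_conj_rectHol {b : ℕ} (hb : 1 ≤ b) (m : ℕ) (U : LGConfig 4 G) :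
    col b U * staple b m U = (U (site2 0 0, 0))⁻¹ * rectHol U (b + 1) m * U (site2 0 0, 0) := by
  have hcol : col b U = (U (site2 0 0, 0))⁻¹ * upT U 0 (b + 1) := by
    rw [← mul_col_eq_upT hb U]; group
  rw [hcol, staple_eq_transport, rectHol]
  push_cast
  group

end QuantStokes

end Summit.QuantumFields.YangMills.Cruxes.IR.RowFloorPoly

end
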